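import Literature.NumberTheory.EllipticCurves.SelmerPInftyGaloisAction
import Literature.NumberTheory.EllipticCurves.ArchimedeanLocalCondition
import Literature.NumberTheory.EllipticCurves.BSDSelmerParityDokchitserBaseChangeProofs
import HarnessLib

/-!
# The action of `Aut(K/k)` on `H¹(K, E)` and `H¹(K, E[p^∞])` for `E/k`; stability of `Sel_{p^∞}(E_K/K)`

The **relative** companion of `Literature.NumberTheory.EllipticCurves.SelmerGaloisAction`
(§ Transport) and `Literature.NumberTheory.EllipticCurves.SelmerPInftyGaloisAction`, whose
transport and stability statements are written for a curve `E = W/ℚ` and `σ ∈ Aut(K/ℚ)` (there the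
double base change `(W⁄K)⁄F = W⁄F` holds on the nose for every characteristic-`0` field `F`, by
`Subsingleton (ℚ →+* F)`). Here the curve `E = W` is defined over an arbitrary field `k`, `K/k` is
a field extension and `σ ∈ Aut(K/k)`; this is the setting of Dokchitser–Dokchitser, Ann. of Math.
172 (2010), Lemma 4.14 and Cor. 4.15 (`E/K` an elliptic curve over a *number field* `K`, `F/K`
finite Galois, `G = Gal(F/K)` acting on `Sel_{p^∞}(E/F)`, p. 24: "`X_p(E/F)` as a
`G`-representation"), where the base of the curve is the bottom field of the Galois extension and
not `ℚ`. The action itself (`IsLiftOfAut.conjGalCMH`, `IsLiftOfAut.pointsMap`, file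
`SelmerGaloisAction`) is already built over any base `k`; what is redone here over `k` is:

* `relLocalPointsMap W Θ hΘ : E(K̄_E) → E(K̄_{E'})` — the map on local points along a ring
  isomorphism `Θ : K̄_E ≃+* K̄_{E'}` fixing `k` (`IsBaseFixing`), through Mathlib's
  `Affine.Point.map` for the composite `k`-algebra structures `k → K → K̄_E` (in place of
  `toRatAlgHom`), and its compatibilities (`relLocalPointsMap_some`,
  `IsLiftOfRingEquiv.relLocalPointsMap_smul`, `IsLiftOfRingEquiv.relMap_injective`);
* `relEmbOfLifts` — the `K`-embedding `ι' = Θ ∘ ι_E ∘ τ⁻¹ : K̄ → K̄_{E'}` built from a lift `τ` of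
  `σ` and a lift `Θ` of a `σ`-semilinear `θ : E ≃+* E'` (`IsRelSemilinear`), and the equality of
  the two composite compatible pairs (`conjGalCMH_comp_resGalOfEmb_relEmbOfLifts`,
  `pointsMapOfEmb_relEmbOfLifts_comp_pointsMap`);
* `IsLiftOfAut.relConjH1Points`, `IsLiftOfAut.relConjH1Primary` — the action of a lift `τ` on
  `H¹(K, E)` and on `H¹(K, E[p^∞])` for `E/k`, commuting with `H¹(K, E[p^∞]) → H¹(K, E)`
  (`primaryH1ToH1_relConjH1Primary`);
* **transport of the local condition** (`relConjH1Points_mem_localRestrictionKer_iff`,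
  `relConjH1Primary_mem_selmerLocalKerPrimary_iff`): for a `σ`-semilinear `θ : E ≃+* E'` of
  `K`-fields, `τ_* x` dies in `H¹(E', E)` iff `x` dies in `H¹(E, E)` — verbatim the argument of
  `conjH1Points_mem_localRestrictionKer_iff` (Cassels–Fröhlich, Ch. VII §1.1);
* **stability** of the finite Selmer conditions of `E_K/K` under `Aut(K/k)` for a number field `K`
  (`relConjH1Primary_mem_finSelmerGroupPInfty`, with the Galois transport of completions
  `galAdicCompletionEquiv σ : K_{σ⁻¹ v} ≃+* K_v`, which is `σ`-semilinear,
  `isRelSemilinear_galAdicCompletionEquiv`), and, for an odd prime `p`, of the whole Selmer group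
  `Sel_{p^∞}(E_K/K)` (`relConjH1Primary_mem_selmerGroupPInfty`): for `p` odd the archimedean
  conditions hold automatically on the `p`-primary group `H¹(K, E[p^∞])`, being satisfied by `2η`
  for every `η` (`two_nsmul_mem_selmerLocalKerPrimary_infinitePlace`), so that
  `Sel_{p^∞}(E_K/K)` is the group cut out by the finite conditions
  (`selmerGroupPInfty_eq_finSelmerGroupPInfty_of_ne_two`).

This is the `Gal(F/K)`-module structure on `Sel_{p^∞}(E/F)` of Dokchitser–Dokchitser 2010,
Lemma 4.14, for `E` over a general number field `K`. Everything here is proved; no named fact is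
introduced.

## References

* T. Dokchitser, V. Dokchitser, *On the Birch–Swinnerton-Dyer quotients modulo squares*, Ann. of
  Math. 172 (2010), Lemma 4.14, Cor. 4.15. [DokchitserDokchitserAnnals2010]
* J. W. S. Cassels, A. Fröhlich (eds.), *Algebraic Number Theory* (1967), Ch. VII (Tate) §1.1.
  [CasselsFrohlichANT1967]
* J.-P. Serre, *Galois Cohomology* (1997), I.§2.4, II.§1.1. [SerreGaloisCohomology1997]
-/

noncomputable section

open scoped Classical

universe u v

namespace Literature.NumberTheory.EllipticCurves

open GaloisRepresentations WeierstrassCurve CategoryTheory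

/-! ## Transport of local points along ring isomorphisms fixing the base `k` -/

section Transport

variable {k : Type v} {K : Type u} [Field k] [Field K] [Algebra k K] (W : WeierstrassCurve k)
variable {E E' : Type u} [Field E] [Algebra K E] [Field E'] [Algebra K E']

local notation "Kbar" => AlgebraicClosure K
local notation "KE" => AlgebraicClosure E
local notation "KE'" => AlgebraicClosure E'

/-- `θ : E ≃+* E'` is **`σ`-semilinear** for `σ ∈ Aut(K/k)`: `θ (ι_E x) = ι_{E'} (σ x)` for
`x ∈ K` (e.g. the Galois transport `σ_v : K_v → K_{σ v}` of completions of a Galois extension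
`K/k`, Cassels–Fröhlich, Ch. VII §1.1). The relative form of the tree's `IsSemilinearRingEquiv`
(which has `k = ℚ`). [folklore] -/
def IsRelSemilinear (σ : K ≃ₐ[k] K) (θ : E ≃+* E') : Prop :=
  ∀ x : K, θ (algebraMap K E x) = algebraMap K E' (σ x)

variable (k K) in
/-- A ring isomorphism `Θ : K̄_E ≃+* K̄_{E'}` between algebraic closures of two `K`-fields **fixes
the base `k`**: it is the identity on the image of `k → K → K̄_E`. (Automatic for `k = ℚ`; for a
lift of a `σ`-semilinear isomorphism with `σ ∈ Aut(K/k)` it holds by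
`isBaseFixing_of_isLiftOfRingEquiv`.) [folklore] -/
def IsBaseFixing (Θ : KE ≃+* KE') : Prop :=
  ∀ a : k, Θ (algebraMap K KE (algebraMap k K a)) = algebraMap K KE' (algebraMap k K a)

omit W in
/-- The inverse of a base-fixing isomorphism fixes the base. [folklore] -/
theorem IsBaseFixing.symm {Θ : KE ≃+* KE'} (h : IsBaseFixing k K Θ) : IsBaseFixing k K Θ.symm :=
  fun a ↦ by
    apply Θ.injective
    rw [RingEquiv.apply_symm_apply, h]

omit W in
/-- A lift `Θ` of a `σ`-semilinear `θ : E ≃+* E'`, `σ ∈ Aut(K/k)`, fixes `k`: on `k` the twist by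
`σ` is trivial. [folklore] -/
theorem isBaseFixing_of_isLiftOfRingEquiv {σ : K ≃ₐ[k] K} {θ : E ≃+* E'} {Θ : KE ≃+* KE'}
    (hθ : IsRelSemilinear σ θ) (hΘ : IsLiftOfRingEquiv θ Θ) : IsBaseFixing k K Θ := fun a ↦ by
  rw [IsScalarTower.algebraMap_apply K E KE, hΘ, hθ, AlgEquiv.commutes,
    ← IsScalarTower.algebraMap_apply]

variable (k K) in
/-- The composite `k`-algebra structure `k → K → F` on a `K`-algebra `F` (a reducible definition,
*not* an instance: used under `letI` to view `Θ : K̄_E ≃+* K̄_{E'}` as a `k`-algebra map).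
[folklore] -/
abbrev compAlgebra (F : Type*) [CommRing F] [Algebra K F] : Algebra k F :=
  ((algebraMap K F).comp (algebraMap k K)).toAlgebra

/-- The double base change `(W⁄K)⁄F` of `W/k` along a `K`-algebra `F` is the base change of `W`
along the composite `k → K → F` (Mathlib `WeierstrassCurve.map_map`). [folklore] -/
theorem baseChange_baseChange_eq_comp (F : Type*) [Field F] [Algebra K F] :
    (W.baseChange K).baseChange F = (letI : Algebra k F := compAlgebra k K F; W.baseChange F) := by
  change (W.map (algebraMap k K)).map (algebraMap K F) = W.map ((algebraMap K F).comp (algebraMap k K))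
  rw [WeierstrassCurve.map_map]

/-- A base-fixing ring isomorphism `Θ : K̄_E ≃+* K̄_{E'}` on local points `E(K̄_E) → E(K̄_{E'})`
of `E = W/k`: coordinates moved by `Θ`, viewed as a `k`-algebra map for the composite `k`-algebra
structures `k → K → K̄_E`, `k → K → K̄_{E'}` (Mathlib `Affine.Point.map` on `W⁄K̄_E`), transported
across `(W⁄K)⁄K̄_E = W⁄K̄_E` by the tree's `Affine.Point.congrEquiv`. The relative form of
`localPointsMap` (`k = ℚ`). [folklore] -/
def relLocalPointsMap (Θ : KE ≃+* KE') (hΘ : IsBaseFixing k K Θ) :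
    localPoints (W.baseChange K) E →+ localPoints (W.baseChange K) E' :=
  letI : Algebra k KE := compAlgebra k K KE
  letI : Algebra k KE' := compAlgebra k K KE'
  let Θₐ : KE →ₐ[k] KE' := { Θ.toRingHom with commutes' := hΘ }
  (WeierstrassCurve.Affine.Point.congrEquiv
      (baseChange_baseChange_eq_comp W (K := K) KE')).symm.toAddMonoidHom.comp
    ((WeierstrassCurve.Affine.Point.map (W' := W) Θₐ).comp
      (WeierstrassCurve.Affine.Point.congrEquiv
        (baseChange_baseChange_eq_comp W (K := K) KE)).toAddMonoidHom)

/-- `relLocalPointsMap` sends `O` to `O`. [folklore] -/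
theorem relLocalPointsMap_zero (Θ : KE ≃+* KE') (hΘ : IsBaseFixing k K Θ) :
    relLocalPointsMap W Θ hΘ (0 : localPoints (W.baseChange K) E) = 0 :=
  map_zero _

/-- A base-fixing `Θ` preserves nonsingularity of affine points of `(W⁄K)⁄K̄_E` (via
`(W⁄K)⁄K̄_E = W⁄K̄_E` and Mathlib `Affine.baseChange_nonsingular`). [folklore] -/
theorem nonsingular_of_isBaseFixing {Θ : KE ≃+* KE'} (hΘ : IsBaseFixing k K Θ) {x y : KE}
    (h : ((W.baseChange K).baseChange KE).toAffine.Nonsingular x y) :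
    ((W.baseChange K).baseChange KE').toAffine.Nonsingular (Θ x) (Θ y) := by
  letI : Algebra k KE := compAlgebra k K KE
  letI : Algebra k KE' := compAlgebra k K KE'
  let Θₐ : KE →ₐ[k] KE' := { Θ.toRingHom with commutes' := hΘ }
  have h1 : (W.baseChange KE).toAffine.Nonsingular x y := by
    rw [← baseChange_baseChange_eq_comp W (K := K) KE]; exact h
  have h2 := (WeierstrassCurve.Affine.baseChange_nonsingular (W := W.toAffine) (A := KE) (B := KE')
    (S := k) (f := Θₐ) (RingHom.injective _) x y).mpr h1
  rw [baseChange_baseChange_eq_comp W (K := K) KE']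
  exact h2

/-- `relLocalPointsMap` is `Θ` on coordinates. [folklore] -/
theorem relLocalPointsMap_some (Θ : KE ≃+* KE') (hΘ : IsBaseFixing k K Θ) (x y : KE)
    (h : ((W.baseChange K).baseChange KE).toAffine.Nonsingular x y) :
    relLocalPointsMap W Θ hΘ (show localPoints (W.baseChange K) E from .some x y h) =
      (show localPoints (W.baseChange K) E' from
        .some (Θ x) (Θ y) (nonsingular_of_isBaseFixing W hΘ h)) := by
  letI : Algebra k KE := compAlgebra k K KE
  letI : Algebra k KE' := compAlgebra k K KE'
  let Θₐ : KE →ₐ[k] KE' := { Θ.toRingHom with commutes' := hΘ }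
  show (WeierstrassCurve.Affine.Point.congrEquiv
      (baseChange_baseChange_eq_comp W (K := K) KE')).symm
        (WeierstrassCurve.Affine.Point.map (W' := W) Θₐ
          (WeierstrassCurve.Affine.Point.congrEquiv
            (baseChange_baseChange_eq_comp W (K := K) KE) (.some x y h))) = _
  rw [WeierstrassCurve.Affine.Point.congrEquiv_some, WeierstrassCurve.Affine.Point.map_some,
    AddEquiv.symm_apply_eq, WeierstrassCurve.Affine.Point.congrEquiv_some]
  rfl

/-- `Θ` followed by `Θ⁻¹` on points is the identity. [folklore] -/
theorem relLocalPointsMap_symm_apply (Θ : KE ≃+* KE') (hΘ : IsBaseFixing k K Θ)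
    (P : localPoints (W.baseChange K) E) :
    relLocalPointsMap W Θ.symm hΘ.symm (relLocalPointsMap W Θ hΘ P) = P := by
  change ((W.baseChange K).baseChange KE).toAffine.Point at P
  rcases P with _ | ⟨x, y, h⟩
  · exact (congrArg _ (relLocalPointsMap_zero W Θ hΘ)).trans (relLocalPointsMap_zero W Θ.symm _)
  · rw [relLocalPointsMap_some W Θ hΘ x y h, relLocalPointsMap_some W Θ.symm]
    exact Affine.Point.some_eq_some_of_eq (Θ.symm_apply_apply x) (Θ.symm_apply_apply y)

variable {θ : E ≃+* E'} {Θ : AlgebraicClosure E ≃+* AlgebraicClosure E'}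

/-- Compatibility of the pair `(conjGalCMH, relLocalPointsMap)`: `Θ (Θ⁻¹ g Θ • P) = g • Θ P`.
Serre, *Galois Cohomology*, I.§2.4. [folklore] -/
theorem IsLiftOfRingEquiv.relLocalPointsMap_smul (hΘ : IsLiftOfRingEquiv θ Θ)
    (hΘk : IsBaseFixing k K Θ) (g : Field.absoluteGaloisGroup E')
    (P : localPoints (W.baseChange K) E) :
    relLocalPointsMap W Θ hΘk (hΘ.conjGalCMH g • P) = g • relLocalPointsMap W Θ hΘk P := by
  change ((W.baseChange K).baseChange KE).toAffine.Point at P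
  rcases P with _ | ⟨x, y, h⟩
  · change relLocalPointsMap W Θ hΘk (hΘ.conjGalCMH g • (0 : localPoints (W.baseChange K) E)) =
      g • relLocalPointsMap W Θ hΘk (0 : localPoints (W.baseChange K) E)
    rw [smul_zero, relLocalPointsMap_zero, smul_zero]
  · rw [localPoints.smul_def, localPoints.smul_def]
    change relLocalPointsMap W Θ hΘk (WeierstrassCurve.Affine.Point.map _ (.some x y h)) =
      WeierstrassCurve.Affine.Point.map _ (relLocalPointsMap W Θ hΘk (.some x y h))
    rw [WeierstrassCurve.Affine.Point.map_some, relLocalPointsMap_some, relLocalPointsMap_some,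
      WeierstrassCurve.Affine.Point.map_some]
    exact Affine.Point.some_eq_some_of_eq (Θ.apply_symm_apply _) (Θ.apply_symm_apply _)

/-- `relLocalPointsMap Θ⁻¹ ∘ relLocalPointsMap Θ = id`. [folklore] -/
theorem relLocalPointsMap_symm_comp (hΘk : IsBaseFixing k K Θ) :
    (relLocalPointsMap W Θ.symm hΘk.symm :
        localPoints (W.baseChange K) E' →+ localPoints (W.baseChange K) E).comp
      (relLocalPointsMap W Θ hΘk) = AddMonoidHom.id _ :=
  AddMonoidHom.ext (relLocalPointsMap_symm_apply W Θ hΘk)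

/-- The map `H¹(E, E(K̄_E)) → H¹(E', E(K̄_{E'}))` induced by a base-fixing lift `Θ` is injective
(the map induced by `Θ⁻¹` is a left inverse, by `ContinuousCohomology.map_comp` and `map_id`).
[folklore] -/
theorem IsLiftOfRingEquiv.relMap_injective (hΘ : IsLiftOfRingEquiv θ Θ)
    (hΘk : IsBaseFixing k K Θ) :
    Function.Injective (ContinuousCohomology.map hΘ.conjGalCMH
      (resHomOfEquivariant hΘ.conjGalCMH (relLocalPointsMap (K := K) W Θ hΘk)
        (hΘ.relLocalPointsMap_smul W hΘk)) 1) := by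
  have hΘ' : IsLiftOfRingEquiv θ.symm Θ.symm := hΘ.symm
  let ψ' : localPoints (W.baseChange K) E' →+ localPoints (W.baseChange K) E :=
    relLocalPointsMap W Θ.symm hΘk.symm
  have hψ' : ∀ (g : Field.absoluteGaloisGroup E) (P : localPoints (W.baseChange K) E'),
      ψ' (hΘ'.conjGalCMH g • P) = g • ψ' P := hΘ'.relLocalPointsMap_smul W hΘk.symm
  have hcomp := map_one_eq_comp_of_eq hΘ.conjGalCMH (relLocalPointsMap W Θ hΘk)
    (hΘ.relLocalPointsMap_smul W hΘk) hΘ'.conjGalCMH ψ' hψ'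
    (Φ := ContinuousMonoidHom.id _) (Ψ := AddMonoidHom.id _) (fun _ _ ↦ rfl)
    hΘ.conjGalCMH_comp_symm.symm (relLocalPointsMap_symm_comp W (Θ := Θ) hΘk).symm
  rw [map_one_eq_id_of_eq (fun _ _ ↦ rfl) rfl rfl] at hcomp
  intro a b hab
  have ha := congr($hcomp a)
  have hb := congr($hcomp b)
  simp only [ConcreteCategory.id_apply, ConcreteCategory.comp_apply] at ha hb
  rw [ha, hab, ← hb]

variable {σ : K ≃ₐ[k] K} {τ : AlgebraicClosure K ≃+* AlgebraicClosure K}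

/-- The `K`-embedding `ι' : K̄ → K̄_{E'}`, `x ↦ Θ (ι_E (τ⁻¹ x))`, built from a lift `τ` of
`σ ∈ Aut(K/k)`, the chosen embedding `ι_E : K̄ → K̄_E` and a lift `Θ` of the `σ`-semilinear
`θ : E ≃+* E'`; it is `K`-linear because the two `σ`-twists cancel. The relative form of
`embOfLifts`. Serre, *Galois Cohomology*, II.§1.1. [folklore] -/
def relEmbOfLifts (hτ : IsLiftOfAut σ τ) (hθ : IsRelSemilinear σ θ)
    (hΘ : IsLiftOfRingEquiv θ Θ) :
    AlgebraicClosure K →ₐ[K] AlgebraicClosure E' :=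
  { (Θ.toRingHom.comp (closureEmb (K := K) E).toRingHom).comp τ.symm.toRingHom with
    commutes' := fun x ↦ by
      change Θ (closureEmb (K := K) E (τ.symm (algebraMap K Kbar x))) = algebraMap K KE' x
      rw [hτ.symm_apply, AlgHom.commutes, IsScalarTower.algebraMap_apply K E KE, hΘ, hθ,
        AlgEquiv.apply_symm_apply, ← IsScalarTower.algebraMap_apply] }

/-- Unfolding `relEmbOfLifts`: `ι' x = Θ (ι_E (τ⁻¹ x))`. [folklore] -/
theorem relEmbOfLifts_apply (hτ : IsLiftOfAut σ τ) (hθ : IsRelSemilinear σ θ)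
    (hΘ : IsLiftOfRingEquiv θ Θ) (x : AlgebraicClosure K) :
    relEmbOfLifts hτ hθ hΘ x = Θ (closureEmb (K := K) E (τ.symm x)) := rfl

/-- The Galois sides of the two composite pairs agree:
`τ⁻¹ (res_{ι'} g) τ = res_{ι_E} (Θ⁻¹ g Θ)` for `ι' = Θ ι_E τ⁻¹`. [folklore] -/
theorem conjGalCMH_comp_resGalOfEmb_relEmbOfLifts (hτ : IsLiftOfAut σ τ)
    (hθ : IsRelSemilinear σ θ) (hΘ : IsLiftOfRingEquiv θ Θ) :
    hτ.conjGalCMH.comp (resGalOfEmb (relEmbOfLifts hτ hθ hΘ)) =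
      (resGal (K := K) E).comp hΘ.conjGalCMH := by
  apply ContinuousMonoidHom.ext
  intro g
  apply AlgEquiv.ext
  intro x
  apply (Θ.toRingHom.comp (closureEmb (K := K) E).toRingHom).injective
  change Θ (closureEmb (K := K) E (τ.symm ((show Kbar ≃ₐ[K] Kbar from
      resGalAuxOfEmb (relEmbOfLifts hτ hθ hΘ) g) (τ x)))) =
    Θ (closureEmb (K := K) E ((show Kbar ≃ₐ[K] Kbar from
      resGalAuxOfEmb (closureEmb (K := K) E) (hΘ.conjGalCMH g)) x))
  rw [← relEmbOfLifts_apply hτ hθ hΘ, apply_resGalAuxOfEmb_apply, apply_resGalAuxOfEmb_apply,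
    relEmbOfLifts_apply]
  change _ = Θ (Θ.symm ((show KE' ≃ₐ[E'] KE' from g) (Θ (closureEmb (K := K) E x))))
  rw [RingEquiv.apply_symm_apply, RingEquiv.symm_apply_apply]

/-- The coefficient sides of the two composite pairs agree on `E(K̄)`:
`ι' (τ P) = Θ (ι_E P)` for `ι' = Θ ι_E τ⁻¹`. [folklore] -/
theorem pointsMapOfEmb_relEmbOfLifts_comp_pointsMap (hτ : IsLiftOfAut σ τ)
    (hθ : IsRelSemilinear σ θ) (hΘ : IsLiftOfRingEquiv θ Θ) :
    (pointsMapOfEmb (W.baseChange K) (relEmbOfLifts hτ hθ hΘ)).comp (hτ.pointsMap W) =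
      (relLocalPointsMap W Θ (isBaseFixing_of_isLiftOfRingEquiv hθ hΘ)).comp
        (pointsMap (W.baseChange K) E) := by
  ext R
  change pointsMapOfEmb (W.baseChange K) (relEmbOfLifts hτ hθ hΘ) (hτ.pointsMap W R) =
    relLocalPointsMap W Θ _ (pointsMap (W.baseChange K) E R)
  change ((W.baseChange K).baseChange Kbar).toAffine.Point at R
  rcases R with _ | ⟨x, y, h⟩
  · exact (relLocalPointsMap_zero W Θ _).symm
  · change _ = relLocalPointsMap W Θ _ (WeierstrassCurve.Affine.Point.map (W' := W.baseChange K)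
      (closureEmb (K := K) E) (.some x y h))
    rw [WeierstrassCurve.Affine.Point.map_some, relLocalPointsMap_some]
    exact Affine.Point.some_eq_some_of_eq
      (show Θ (closureEmb (K := K) E (τ.symm (τ x))) = _ by rw [RingEquiv.symm_apply_apply])
      (show Θ (closureEmb (K := K) E (τ.symm (τ y))) = _ by rw [RingEquiv.symm_apply_apply])

/-! ## The action on `H¹(K, E)` and transport of the local condition -/

/-- The automorphism of `H¹(K, E)` induced by a lift `τ` of `σ ∈ Aut(K/k)`, for `E = W/k`:
`[f] ↦ [g ↦ τ f(τ⁻¹ g τ)]` (the map of the compatible pair `(conjGalCMH, pointsMap)`). The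
relative form of `IsLiftOfAut.conjH1Points`. Serre, *Galois Cohomology*, I.§2.4;
Dokchitser–Dokchitser 2010, Lemma 4.14. [folklore] -/
def IsLiftOfAut.relConjH1Points (hτ : IsLiftOfAut σ τ) :
    (W.baseChange K).galH1 →+ (W.baseChange K).galH1 :=
  resH1Hom hτ.conjGalCMH (hτ.pointsMap W) (hτ.pointsMap_smul W)

/-- **Transport of the local condition along a `σ`-semilinear isomorphism**, for `E = W/k` and
`σ ∈ Aut(K/k)` with lift `τ`: for a `σ`-semilinear ring isomorphism `θ : E ≃+* E'` of `K`-fields,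
a class `x ∈ H¹(K, E)` dies in `H¹(E, E)` iff `τ_* x` dies in `H¹(E', E)`. With the embedding
`ι' = Θ ι_E τ⁻¹` at `E'` (allowed by `localRestrictionKerOfEmb_eq_holds`) the pair computing
`(τ_* x)|_{E'}` is the pair computing `x|_E` followed by the isomorphism of pairs induced by a
lift `Θ` of `θ`, whose `H¹`-map is injective. (Cassels–Fröhlich, Ch. VII §1.1; the tree's
`conjH1Points_mem_localRestrictionKer_iff` for `k = ℚ`.)
[cite: CasselsFrohlichANT1967, Ch. VII §1.1] -/
theorem relConjH1Points_mem_localRestrictionKer_iff (hτ : IsLiftOfAut σ τ) (θ : E ≃+* E')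
    (hθ : IsRelSemilinear σ θ) (x : (W.baseChange K).galH1) :
    hτ.relConjH1Points W x ∈ (W.baseChange K).localRestrictionKer E' ↔
      x ∈ (W.baseChange K).localRestrictionKer E := by
  have hΘ : IsLiftOfRingEquiv θ (ringEquivLift θ) := isLiftOfRingEquiv_ringEquivLift θ
  have hΘk : IsBaseFixing k K (ringEquivLift θ) := isBaseFixing_of_isLiftOfRingEquiv hθ hΘ
  set ι' := relEmbOfLifts hτ hθ hΘ with hι'
  rw [← localRestrictionKerOfEmb_eq_holds (W.baseChange K) E' ι']
  -- the two composite pairs and their `H¹` maps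
  have hA := map_one_eq_comp_of_eq hτ.conjGalCMH (hτ.pointsMap W) (hτ.pointsMap_smul W)
    (resGalOfEmb ι') (pointsMapOfEmb (W.baseChange K) ι') (pointsMapOfEmb_smul _ ι')
    (Φ := hτ.conjGalCMH.comp (resGalOfEmb ι'))
    (Ψ := (pointsMapOfEmb (W.baseChange K) ι').comp (hτ.pointsMap W))
    (fun g P ↦ by
      simp only [AddMonoidHom.coe_comp, Function.comp_apply, ContinuousMonoidHom.comp_toFun]
      rw [hτ.pointsMap_smul W]
      exact pointsMapOfEmb_smul _ ι' g _) rfl rfl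
  have hB := map_one_eq_comp_of_eq (resGal (K := K) E) (pointsMap (W.baseChange K) E)
    (pointsMap_smul _ E) hΘ.conjGalCMH (relLocalPointsMap W (ringEquivLift θ) hΘk)
    (hΘ.relLocalPointsMap_smul W hΘk)
    (Φ := (resGal (K := K) E).comp hΘ.conjGalCMH)
    (Ψ := (relLocalPointsMap W (ringEquivLift θ) hΘk).comp (pointsMap (W.baseChange K) E))
    (fun g P ↦ by
      simp only [AddMonoidHom.coe_comp, Function.comp_apply, ContinuousMonoidHom.comp_toFun]
      rw [← hΘ.relLocalPointsMap_smul W hΘk]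
      congr 1
      exact pointsMap_smul _ E _ _) rfl rfl
  have hAB := map_one_pair_congr (conjGalCMH_comp_resGalOfEmb_relEmbOfLifts hτ hθ hΘ)
    (pointsMapOfEmb_relEmbOfLifts_comp_pointsMap W hτ hθ hΘ)
    (fun g P ↦ by
      simp only [AddMonoidHom.coe_comp, Function.comp_apply, ContinuousMonoidHom.comp_toFun]
      rw [hτ.pointsMap_smul W]
      exact pointsMapOfEmb_smul _ ι' g _)
    (fun g P ↦ by
      simp only [AddMonoidHom.coe_comp, Function.comp_apply, ContinuousMonoidHom.comp_toFun]
      rw [← hΘ.relLocalPointsMap_smul W hΘk]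
      congr 1
      exact pointsMap_smul _ E _ _)
  rw [hA, hB] at hAB
  -- conclude
  rw [localRestrictionKerOfEmb, mem_resKer_iff, localRestrictionKer, mem_resKer_iff,
    IsLiftOfAut.relConjH1Points, resH1Hom]
  simp only [LinearMap.toAddMonoidHom_coe, ContinuousLinearMap.coe_coe]
  rw [← ConcreteCategory.comp_apply, hAB, ConcreteCategory.comp_apply]
  constructor
  · intro h
    apply IsLiftOfRingEquiv.relMap_injective W hΘ hΘk
    rw [h, map_zero]
  · intro h
    rw [h, map_zero]

end Transport

/-! ## The action on `E[p^∞]` and on `H¹(K, E[p^∞])` -/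

section Primary

variable {k : Type v} {K : Type u} [Field k] [Field K] [Algebra k K] (W : WeierstrassCurve k)
  (p : ℕ)
variable {σ : K ≃ₐ[k] K} {τ : AlgebraicClosure K ≃+* AlgebraicClosure K}

/-- The action of a lift `τ` of `σ ∈ Aut(K/k)` on the `p`-primary torsion `E[p^∞] ⊆ E(K̄)` of
`E = W/k` over `K` (a homomorphism preserves `p`-power torsion). The relative form of
`IsLiftOfAut.primaryTorsionMap`. [folklore] -/
def IsLiftOfAut.relPrimaryTorsionMap (hτ : IsLiftOfAut σ τ) :
    geomPrimaryTorsion (W.baseChange K) p →+ geomPrimaryTorsion (W.baseChange K) p :=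
  ((hτ.pointsMap W).comp (geomPrimaryTorsion (W.baseChange K) p).subtype).codRestrict _ fun P ↦ by
    obtain ⟨n, hn⟩ := AddCommGroup.mem_primaryComponent.mp P.2
    refine AddCommGroup.mem_primaryComponent.mpr ⟨n, ?_⟩
    rw [AddMonoidHom.coe_comp, AddSubgroup.coe_subtype, Function.comp_apply, ← map_nsmul, hn,
      map_zero]

/-- Unfolding `relPrimaryTorsionMap` on underlying points. [folklore] -/
@[simp]
theorem IsLiftOfAut.coe_relPrimaryTorsionMap (hτ : IsLiftOfAut σ τ)
    (P : geomPrimaryTorsion (W.baseChange K) p) :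
    (hτ.relPrimaryTorsionMap W p P : geomPoints (W.baseChange K)) = hτ.pointsMap W P :=
  rfl

/-- Compatibility of the pair `(conjGalCMH, relPrimaryTorsionMap)` (from `pointsMap_smul`).
[folklore] -/
theorem IsLiftOfAut.relPrimaryTorsionMap_smul (hτ : IsLiftOfAut σ τ)
    (g : Field.absoluteGaloisGroup K) (P : geomPrimaryTorsion (W.baseChange K) p) :
    hτ.relPrimaryTorsionMap W p (hτ.conjGalCMH g • P) = g • hτ.relPrimaryTorsionMap W p P :=
  Subtype.ext (hτ.pointsMap_smul W g P)

/-- The automorphism of `H¹(K, E[p^∞])` induced by a lift `τ` of `σ ∈ Aut(K/k)`, for `E = W/k`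
(the map of the compatible pair `(conjGalCMH, relPrimaryTorsionMap)`): the `G`-action on
`H¹(F, E[p^∞]) ⊇ Sel_{p^∞}(E/F)` of Dokchitser–Dokchitser 2010, Lemma 4.14, for `E` over the
bottom field of `F/K`. The relative form of `IsLiftOfAut.conjH1Primary`.
[cite: DokchitserDokchitserAnnals2010, Lemma 4.14] -/
def IsLiftOfAut.relConjH1Primary (hτ : IsLiftOfAut σ τ) :
    galH1Primary (W.baseChange K) p →+ galH1Primary (W.baseChange K) p :=
  resH1Hom hτ.conjGalCMH (hτ.relPrimaryTorsionMap W p) (hτ.relPrimaryTorsionMap_smul W p)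

/-- **The actions commute with `H¹(K, E[p^∞]) → H¹(K, E)`**: both composites are the map of the
pair `(conjGalCMH, E[p^∞] ↪ E(K̄) → E(K̄))`. [folklore] -/
theorem primaryH1ToH1_relConjH1Primary (hτ : IsLiftOfAut σ τ)
    (s : galH1Primary (W.baseChange K) p) :
    primaryH1ToH1 (W.baseChange K) p (hτ.relConjH1Primary W p s) =
      hτ.relConjH1Points W (primaryH1ToH1 (W.baseChange K) p s) := by
  rw [primaryH1ToH1, IsLiftOfAut.relConjH1Primary, IsLiftOfAut.relConjH1Points, resH1Hom_resH1Hom,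
    resH1Hom_resH1Hom]
  exact congrFun (congrArg DFunLike.coe (resH1Hom_congr (by ext; rfl) (by ext; rfl) _ _)) s

variable {E E' : Type u} [Field E] [Algebra K E] [Field E'] [Algebra K E']

/-- **Transport of the `p^∞`-Selmer local condition**, for `E = W/k` and `σ ∈ Aut(K/k)`: for a
`σ`-semilinear `θ : E ≃+* E'`, `τ_* s` satisfies the Selmer condition at `E'` iff `s` satisfies
it at `E` (the conditions are the preimages of the `H¹(·, E)` conditions,
`selmerLocalKerPrimary_eq_comap`). [cite: CasselsFrohlichANT1967, Ch. VII §1.1] -/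
theorem relConjH1Primary_mem_selmerLocalKerPrimary_iff (hτ : IsLiftOfAut σ τ)
    (θ : E ≃+* E') (hθ : IsRelSemilinear σ θ) (s : galH1Primary (W.baseChange K) p) :
    hτ.relConjH1Primary W p s ∈ selmerLocalKerPrimary (W.baseChange K) E' p ↔
      s ∈ selmerLocalKerPrimary (W.baseChange K) E p := by
  rw [selmerLocalKerPrimary_eq_comap, selmerLocalKerPrimary_eq_comap, AddSubgroup.mem_comap,
    AddSubgroup.mem_comap, primaryH1ToH1_relConjH1Primary]
  exact relConjH1Points_mem_localRestrictionKer_iff W hτ θ hθ _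

end Primary

/-! ## Stability of the finite Selmer conditions under `Aut(K/k)` -/

section FinSelmer

open NumberField IsDedekindDomain Literature.NumberTheory.Automorphic

variable {k : Type v} {K : Type u} [Field k] [Field K] [Algebra k K] [NumberField K]
variable (W : WeierstrassCurve k) (p : ℕ) {σ : K ≃ₐ[k] K}
  {τ : AlgebraicClosure K ≃+* AlgebraicClosure K}

omit W in
/-- The Galois transport `K_v ≃+* K_{σ v}` of completions (tree `galAdicCompletionEquiv`, file
`Automorphic/GaloisActionPlaces`; Cassels–Fröhlich, Ch. VII §1.1) is `σ`-semilinear, for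
`σ ∈ Aut(K/k)`. [cite: CasselsFrohlichANT1967, Ch. VII §1.1] -/
theorem isRelSemilinear_galAdicCompletionEquiv (σ : K ≃ₐ[k] K)
    {v v' : HeightOneSpectrum (𝓞 K)} (h : σ • v = v') :
    IsRelSemilinear σ (galAdicCompletionEquiv (L := K) σ h) := fun x ↦ by
  change galAdicCompletionMap σ h (x : v.adicCompletion K) = ((σ x : K) : v'.adicCompletion K)
  exact galAdicCompletionMap_coe_algEquiv k σ h x

/-- **The finite Selmer conditions of `E = W/k` over a number field `K ⊇ k` are stable under
`Aut(K/k)`**: `τ_*` carries the condition at `σ⁻¹ v` to the condition at `v`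
(`relConjH1Primary_mem_selmerLocalKerPrimary_iff` with the Galois transport of completions
`galAdicCompletionEquiv σ : K_{σ⁻¹ v} ≃+* K_v`, which is `σ`-semilinear). This is the
`Gal(F/K)`-stability of `Sel_{p^∞}(E/F)` away from the archimedean conditions
(Dokchitser–Dokchitser 2010, Lemma 4.14: `Sel_{p^∞}(E/F)` as a `G`-module, `E/K`, `F/K` Galois).
[cite: DokchitserDokchitserAnnals2010, Lemma 4.14] -/
theorem relConjH1Primary_mem_finSelmerGroupPInfty (hτ : IsLiftOfAut σ τ)
    {s : galH1Primary (W.baseChange K) p} (hs : s ∈ (W.baseChange K).finSelmerGroupPInfty p) :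
    hτ.relConjH1Primary W p s ∈ (W.baseChange K).finSelmerGroupPInfty p := by
  rw [WeierstrassCurve.mem_finSelmerGroupPInfty_iff] at hs ⊢
  intro v'
  have h : σ • (σ⁻¹ • v') = v' := smul_inv_smul σ v'
  exact (relConjH1Primary_mem_selmerLocalKerPrimary_iff W p hτ (galAdicCompletionEquiv (L := K) σ h)
    (isRelSemilinear_galAdicCompletionEquiv σ h) s).mpr (hs _)

end FinSelmer

/-! ## Odd `p`: the archimedean conditions are automatic; stability of `Sel_{p^∞}(E_K/K)` -/

section OddPrime

open NumberField IsDedekindDomain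

variable {K : Type} [Field K] [NumberField K]

/-- **For `p` odd the `p^∞`-Selmer local condition at an infinite place is automatic**: every
class `η ∈ H¹(K, E[p^∞])` of a Weierstrass curve `V` over a number field `K` lies in
`selmerLocalKerPrimary V K_w p` for every infinite place `w`. Indeed `H¹(K, E[p^∞])` is
`p`-primary (`exists_pow_nsmul_eq_zero_galH1Primary`), so for `p` odd `η = 2 η'` with
`η' = ((p^m + 1)/2) η`, and `2 η'` satisfies the condition
(`two_nsmul_mem_selmerLocalKerPrimary_infinitePlace`: `H¹(ℝ, ·)` is killed by `2`, `H¹(ℂ, ·) = 0`).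
Serre, *Galois Cohomology*, I.§2.4 (Cor. to Prop. 9).
[cite: SerreGaloisCohomology1997, I.§2.4 Cor. to Prop. 9] -/
theorem mem_selmerLocalKerPrimary_infinitePlace_of_ne_two (V : WeierstrassCurve K) (p : ℕ)
    [Fact p.Prime] (hp : p ≠ 2) (w : InfinitePlace K) (η : galH1Primary V p) :
    η ∈ selmerLocalKerPrimary V w.Completion p := by
  obtain ⟨m, hm⟩ := exists_pow_nsmul_eq_zero_galH1Primary V p η
  have hodd : Odd (p ^ m) := ((Fact.out : p.Prime).odd_of_ne_two hp).pow
  obtain ⟨c, hc⟩ := hodd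
  have key : 2 • ((c + 1) • η) = η := by
    rw [← mul_nsmul', show 2 * (c + 1) = p ^ m + 1 by omega, add_nsmul, hm, one_nsmul, zero_add]
  rw [← key]
  exact two_nsmul_mem_selmerLocalKerPrimary_infinitePlace V p w _

/-- For `p` odd, `Sel_{p^∞}(E/K)` is the subgroup of `H¹(K, E[p^∞])` cut out by the conditions at
the **finite** places alone (`finSelmerGroupPInfty`), the archimedean conditions being automatic
(`mem_selmerLocalKerPrimary_infinitePlace_of_ne_two`). [folklore] -/
theorem selmerGroupPInfty_eq_finSelmerGroupPInfty_of_ne_two (V : WeierstrassCurve K) (p : ℕ)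
    [Fact p.Prime] (hp : p ≠ 2) : selmerGroupPInfty V p = V.finSelmerGroupPInfty p := by
  rw [WeierstrassCurve.selmerGroupPInfty_eq_finSelmerGroupPInfty_inf]
  refine le_antisymm inf_le_left (le_inf le_rfl ?_)
  intro η _
  rw [AddSubgroup.mem_iInf]
  intro w
  exact mem_selmerLocalKerPrimary_infinitePlace_of_ne_two V p hp w η

variable {k : Type} [Field k] [Algebra k K] (W : WeierstrassCurve k) (p : ℕ) [Fact p.Prime]
  {σ : K ≃ₐ[k] K} {τ : AlgebraicClosure K ≃+* AlgebraicClosure K}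

/-- **`Sel_{p^∞}(E_K/K)` is stable under `Aut(K/k)` for `p` odd** (`E = W/k`, `K ⊇ k` a number
field): the `Gal(F/K)`-module structure on `Sel_{p^∞}(E/F)` of Dokchitser–Dokchitser 2010,
Lemma 4.14 and Cor. 4.15 (p. 24: "Thus, fix a number field `K`, an odd prime `p`"), from the
stability of the finite conditions (`relConjH1Primary_mem_finSelmerGroupPInfty`) and
`selmerGroupPInfty_eq_finSelmerGroupPInfty_of_ne_two`.
[cite: DokchitserDokchitserAnnals2010, Lemma 4.14 and Cor. 4.15] -/
theorem relConjH1Primary_mem_selmerGroupPInfty (hp : p ≠ 2) (hτ : IsLiftOfAut σ τ)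
    {s : galH1Primary (W.baseChange K) p} (hs : s ∈ selmerGroupPInfty (W.baseChange K) p) :
    hτ.relConjH1Primary W p s ∈ selmerGroupPInfty (W.baseChange K) p := by
  rw [selmerGroupPInfty_eq_finSelmerGroupPInfty_of_ne_two _ p hp] at hs ⊢
  exact relConjH1Primary_mem_finSelmerGroupPInfty W p hτ hs

end OddPrime

end Literature.NumberTheory.EllipticCurves
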